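import Summits.HodgeConjecture.HodgeConjecture.Theorems.K2LiuGL2PrimitiveCosets

/-!
# The split `T(ϖ^{m+2}) = [K diag(ϖ^{m+2},1) K] + ρ(ϖ) T(ϖ^m)` and the eigenvalues of the primitive double cosets of `GL₂`
# on a spherical vector (LOCAL SEAM of s23, engine F2 of #28s — operator half)

Track B ∕ K2-LIT, hLiu418 = stmt-HodgeConjecture-24832; socket #28s `sig_K2LiuUnramifiedDoublingHeckeIdentity` (U5b ED. 3).
Helper (count-neutral, own head per LEAD R3), GENERIC over a valued field `F` (`ValuativeRel F`) with finite residue field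
`𝓀 = 𝓀[F]`, `q = #𝓀`, a uniformizing element `ϖ`, `K = GL₂(𝒪) = glInt 2 F`, and a representation `ρ` of `GL₂(F)` over a
commutative ring `k`; `z = ϖ·1₂ = zpowDiagGL (fun _ => 1)`, `D(m) = diag(ϖ^m, 1) = zpowDiagGL ![m, 0]` (★ `K2LiuGL2PrimitiveCosets`):

* §5 **`heckeDetOperator_add_two_apply`**: on `V^K`, `T(ϖ^{m+2}) v = [K D(m+2) K] v + ρ(z) (T(ϖ^m) v)` (Shimura Thm. 3.24 (2)
  `T(1, p^k) = T(p^k) − T(p,p) T(p^{k-2})`, here for `GL₂` of a valued field and the concrete operators ★ `heckeOperator` ∕ ★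
  `heckeDetOperator` of `TamagawaHeckeSeries`, from the coset partition ★ `setOf_out_mem_glIntDet_add_two`);
* §6 **`heckeOperator_zpowDiagGL_apply_eq_smul`**: if `v ∈ V^K` is an eigenvector of `T₁ = [K D(1) K]` (eigenvalue `a₁`) and of
  `[K z K] = ρ(z)` (eigenvalue `ω`), then `[K D(m) K] v = e_m v` with `e₀ = 1, e₁ = a₁, e₂ = a₁² − (q+1)ω,
  e_{m+3} = a₁ e_{m+2} − q ω e_{m+1}` — from ★ Tamagawa `sum_heckeOperator_heckeDetOperator_eq_zero` (`T(ϖ^m) = T₁T(ϖ^{m-1}) −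
  qT₂T(ϖ^{m-2})`, `heckeDetOperator_apply_eq_smul_of_eigen`) and §5.

This is the `GL₂` spherical Hecke algebra input of the unramified doubling computation ([Li1992, §3 Thm. 3.1];
[GelbartPiatetskishapiroRallis1987, Part A §6]; [Macdonald1995, Ch. V §3]; [ShimuraIATAF1971, Thm. 3.21, 3.24]). Theorems only; no `sorry`.
HONEST LABEL: HC_CM is proved only modulo the printed citations (2 remaining named inputs: hLiu418 = stmt-HodgeConjecture-24832, h413 =
stmt-HodgeConjecture-24833) until rung 0 closes; this file is unconditional and moves no counter.
-/

set_option autoImplicit false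

set_option linter.dupNamespace false

noncomputable section

open scoped Pointwise
open MulAction ValuativeRel Matrix

namespace Summit.HodgeConjecture.HodgeConjecture.Cruxes.HLiu418.K2LiuGL2HeckePrimitiveSplit

open Literature.NumberTheory.Automorphic
open Summit.HodgeConjecture.HodgeConjecture.Cruxes.HLiu418.K2LiuGL2PrimitiveCosets

variable {F : Type*} [Field F] [ValuativeRel F] {n : ℕ} {ϖ : F}

/-! ## §5 The operator split `T(ϖ^{m+2}) = [K D(m+2) K] + ρ(z) T(ϖ^m)` on `V^K` -/

variable {k V : Type*} [CommRing k] [AddCommGroup V] [Module k V]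

/-- the Hecke operator of a coset `gK` whose `K`-orbit is a single point (e.g. `g` central) is `ρ(g)` on `V^K`.
[cite: ShimuraIATAF1971, Prop. 3.17] -/
theorem heckeOperator_apply_of_comm {G : Type*} [Group G] (ρ : Representation k G V) (K : Subgroup G) {z : G}
    (hz : ∀ κ ∈ K, κ * z = z * κ) {v : V} (hv : v ∈ ρ.fixedPoints K) : heckeOperator ρ K z v = ρ z v := by
  classical
  have hs : Set.BijOn (fun x : G => (x : G ⧸ K)) ({z} : Finset G) (orbit K (z : G ⧸ K)) := by
    refine ⟨fun x hx => ?_, by rw [Finset.coe_singleton]; exact Set.injOn_singleton _ _, fun γ hγ => ?_⟩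
    · rw [Finset.coe_singleton, Set.mem_singleton_iff] at hx
      rw [hx]
      exact mem_orbit_self _
    · obtain ⟨κ, rfl⟩ := (mem_orbit_mk_iff K).1 hγ
      refine ⟨z, by simp, ?_⟩
      change (z : G ⧸ K) = (((κ : G) * z : G) : G ⧸ K)
      rw [hz κ κ.2, QuotientGroup.eq, show z⁻¹ * (z * (κ : G)) = κ by group]
      exact κ.2
  rw [heckeOperator_apply_eq_sum ρ K z {z} hs hv, Finset.sum_singleton]

/-- **`T(ϖ^{m+2}) v = [K D(m+2) K] v + ρ(z) (T(ϖ^m) v)` on `V^K`** — Shimura's `T(1,p^k) = T(p^k) − T(p,p)T(p^{k-2})` for `GL₂`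
of a valued field, for the concrete operators of ★ `TamagawaHeckeSeries`. [cite: ShimuraIATAF1971, Thm. 3.24 (2)] [cite: Macdonald1995, Ch. V §3] -/
theorem heckeDetOperator_add_two_apply [Finite 𝓀[F]] [IsDiscreteValuationRing 𝒪[F]] (hϖ : IsUniformizingElement ϖ) (ρ : Representation k (GL (Fin 2) F) V) (m : ℕ)
    {v : V} (hv : v ∈ ρ.fixedPoints (glInt 2 F)) :
    heckeDetOperator ρ ϖ (m + 2) v =
      heckeOperator ρ (glInt 2 F) (zpowDiagGL hϖ.ne_zero ![((m + 2 : ℕ) : ℤ), 0]) v +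
        ρ (zpowDiagGL hϖ.ne_zero (fun _ : Fin 2 => (1 : ℤ))) (heckeDetOperator ρ ϖ m v) := by
  classical
  set z : GL (Fin 2) F := zpowDiagGL hϖ.ne_zero (fun _ : Fin 2 => (1 : ℤ)) with hzdef
  have hS₂ := finite_cosets_glIntDet (n := 2) hϖ (m + 2)
  have hS₀ := finite_cosets_glIntDet (n := 2) hϖ m
  have hO := finite_orbit_diag hϖ (m + 2)
  have hunion : hS₂.toFinset = hO.toFinset ∪ hS₀.toFinset.image (fun γ => z • γ) := by
    apply Finset.coe_injective
    rw [Finset.coe_union, Finset.coe_image, Set.Finite.coe_toFinset, Set.Finite.coe_toFinset, Set.Finite.coe_toFinset]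
    exact setOf_out_mem_glIntDet_add_two hϖ m
  have hdisj : Disjoint hO.toFinset (hS₀.toFinset.image (fun γ => z • γ)) := by
    rw [← Finset.disjoint_coe, Finset.coe_image, Set.Finite.coe_toFinset, Set.Finite.coe_toFinset]
    exact disjoint_orbit_diag_image_smul hϖ m (m + 2)
  rw [heckeDetOperator_apply_eq_sum ρ (m + 2) hS₂, hunion, Finset.sum_union hdisj, ← heckeOperator_apply_eq_sum_out ρ (glInt 2 F) _ hO hv,
    Finset.sum_image fun x _ y _ h => smul_left_cancel z h, heckeDetOperator_apply_eq_sum ρ m hS₀, map_sum]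
  congr 1
  refine Finset.sum_congr rfl fun γ _ => ?_
  rw [← apply_mul_out_eq ρ (glInt 2 F) hv z γ, map_mul, Module.End.mul_apply]

/-! ## §6 Eigenvalues of the primitive double cosets -/

/-- `heckeDiag 2 ϖ 1 = D(1)`. [cite: ShimuraIATAF1971, Thm. 3.24] -/
theorem heckeDiag_two_one (hϖ : IsUniformizingElement ϖ) :
    heckeDiag 2 (Units.mk0 ϖ hϖ.ne_zero) 1 = zpowDiagGL hϖ.ne_zero ![(1 : ℤ), 0] := by
  refine Units.ext ?_
  rw [coe_heckeDiag, coe_zpowDiagGL]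
  congr 1
  funext j
  fin_cases j <;> simp

/-- `heckeDiag 2 ϖ 2 = z`. [cite: ShimuraIATAF1971, Thm. 3.24] -/
theorem heckeDiag_two_two (hϖ : IsUniformizingElement ϖ) :
    heckeDiag 2 (Units.mk0 ϖ hϖ.ne_zero) 2 = zpowDiagGL hϖ.ne_zero (fun _ : Fin 2 => (1 : ℤ)) := by
  refine Units.ext ?_
  rw [coe_heckeDiag, coe_zpowDiagGL]
  congr 1
  funext j
  have : (j : ℕ) < 2 := j.2
  simp [this]

omit [ValuativeRel F] in
/-- `D(0) = 1`. [cite: ShimuraIATAF1971, Thm. 3.24] -/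
theorem zpowDiagGL_zero_zero (hϖ0 : ϖ ≠ 0) : zpowDiagGL hϖ0 ![((0 : ℕ) : ℤ), 0] = (1 : GL (Fin 2) F) := by
  rw [← zpowDiagGL_zero hϖ0]
  congr 1
  funext j
  fin_cases j <;> simp

omit [ValuativeRel F] in
/-- `heckeDiag 2 ϖ' 0 = 1`. [cite: ShimuraIATAF1971, Thm. 3.24] -/
theorem heckeDiag_two_zero (ϖ' : Fˣ) : heckeDiag 2 ϖ' 0 = (1 : GL (Fin 2) F) := by
  refine Units.ext ?_
  rw [coe_heckeDiag, Units.val_one]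
  simp

/-- the central generator commutes with `K` (with everything). [cite: ShimuraIATAF1971, Prop. 3.17] -/
theorem glInt_mul_scalar_comm (hϖ0 : ϖ ≠ 0) : ∀ κ ∈ glInt n F, κ * zpowDiagGL hϖ0 (fun _ => (1 : ℤ)) = zpowDiagGL hϖ0 (fun _ => (1 : ℤ)) * κ :=
  fun κ _ => (zpowDiagGL_one_mul_comm hϖ0 κ).symm

/-- **`T(ϖ^m) v = r_m v`** with `r₀ = 1, r₁ = a₁, r_{m+2} = a₁ r_{m+1} − q ω r_m`, for `v ∈ V^K` an eigenvector of `T₁` (`a₁`) and of `[K z K]` (`ω`):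
Tamagawa's recursion ★ `sum_heckeOperator_heckeDetOperator_eq_zero` for `GL₂`. [cite: ShimuraIATAF1971, Thm. 3.21] [cite: Macdonald1995, Ch. V §3] -/
theorem heckeDetOperator_apply_eq_smul_of_eigen [Finite 𝓀[F]] (hϖ : IsUniformizingElement ϖ) (ρ : Representation k (GL (Fin 2) F) V)
    {v : V} (hv : v ∈ ρ.fixedPoints (glInt 2 F)) {a₁ ω : k}
    (hT : heckeOperator ρ (glInt 2 F) (zpowDiagGL hϖ.ne_zero ![(1 : ℤ), 0]) v = a₁ • v)
    (hZ : heckeOperator ρ (glInt 2 F) (zpowDiagGL hϖ.ne_zero (fun _ : Fin 2 => (1 : ℤ))) v = ω • v)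
    (r : ℕ → k) (hr0 : r 0 = 1) (hr1 : r 1 = a₁) (hr : ∀ m, r (m + 2) = a₁ * r (m + 1) - (Nat.card 𝓀[F] : k) * ω * r m) (m : ℕ) :
    heckeDetOperator ρ ϖ m v = r m • v := by
  have c02 : Nat.choose 0 2 = 0 := by decide
  have c12 : Nat.choose 1 2 = 0 := by decide
  have c22 : Nat.choose 2 2 = 1 := by decide
  -- `T_0 = 1` on the (fixed) vectors `T(ϖ^j) v`
  have hT0 : ∀ j, heckeOperator ρ (glInt 2 F) (heckeDiag 2 (Units.mk0 ϖ hϖ.ne_zero) 0) (heckeDetOperator ρ ϖ j v) = heckeDetOperator ρ ϖ j v :=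
    fun j => by
      rw [heckeDiag_two_zero]
      exact heckeOperator_one_apply ρ _ (heckeDetOperator_apply_mem_fixedPoints ρ j (finite_cosets_glIntDet hϖ j) hv)
  -- two-step induction
  suffices h : ∀ m, heckeDetOperator ρ ϖ m v = r m • v ∧ heckeDetOperator ρ ϖ (m + 1) v = r (m + 1) • v from (h m).1
  intro m
  induction m with
  | zero =>
    refine ⟨by rw [heckeDetOperator_zero_apply ρ hv, hr0, one_smul], ?_⟩
    -- `T(ϖ) v = T₁ v` (Tamagawa at `m = 1`)
    have h1 := sum_heckeOperator_heckeDetOperator_eq_zero ρ hϖ (m := 1) le_rfl hv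
    rw [show min 1 2 + 1 = 2 from rfl] at h1
    simp only [Finset.sum_range_succ, Finset.sum_range_zero, zero_add, pow_zero, pow_one, c02, c12, mul_one, one_smul, Nat.sub_zero,
      Nat.sub_self, hT0, heckeDetOperator_zero_apply ρ hv, heckeDiag_two_one hϖ, hT, neg_smul, one_smul] at h1
    rw [zero_add, hr1]
    rw [← sub_eq_add_neg, sub_eq_zero] at h1
    exact h1
  | succ m ih =>
    refine ⟨ih.2, ?_⟩
    show heckeDetOperator ρ ϖ (m + 2) v = r (m + 2) • v
    have h2 := sum_heckeOperator_heckeDetOperator_eq_zero ρ hϖ (m := m + 2) (by omega) hv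
    rw [show min (m + 2) 2 + 1 = 3 by omega] at h2
    have t1 : heckeOperator ρ (glInt 2 F) (heckeDiag 2 (Units.mk0 ϖ hϖ.ne_zero) 1) (heckeDetOperator ρ ϖ (m + 1) v) = (r (m + 1) * a₁) • v := by
      rw [ih.2, map_smul, heckeDiag_two_one hϖ, hT, smul_smul]
    have t2 : heckeOperator ρ (glInt 2 F) (heckeDiag 2 (Units.mk0 ϖ hϖ.ne_zero) 2) (heckeDetOperator ρ ϖ m v) = (r m * ω) • v := by
      rw [ih.1, map_smul, heckeDiag_two_two hϖ, hZ, smul_smul]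
    simp only [Finset.sum_range_succ, Finset.sum_range_zero, zero_add, pow_zero, pow_one, c02, c12, c22, mul_one, one_mul, one_smul,
      Nat.sub_zero, show m + 2 - 1 = m + 1 by omega, show m + 2 - 2 = m by omega, hT0, t1, t2, neg_one_sq, smul_smul] at h2
    rw [neg_one_mul, neg_smul] at h2
    rw [hr m]
    have key : heckeDetOperator ρ ϖ (m + 2) v = (r (m + 1) * a₁) • v - ((Nat.card 𝓀[F] : k) * (r m * ω)) • v := by
      rw [← sub_eq_zero, ← h2]; abel
    rw [key, ← sub_smul]
    congr 1
    ring

/-- **THE EIGENVALUES OF THE PRIMITIVE DOUBLE COSETS**: for `v ∈ V^K` with `T₁ v = a₁ v`, `[K z K] v = ω v`,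
`[K diag(ϖ^m, 1) K] v = e_m v` where `e₀ = 1, e₁ = a₁, e₂ = a₁² − (q+1)ω, e_{m+3} = a₁e_{m+2} − qωe_{m+1}` (`q = #𝓀`).
[cite: Macdonald1995, Ch. V §3 (3.9)] [cite: ShimuraIATAF1971, Thm. 3.24] [cite: Li1992, §3 Thm. 3.1] -/
theorem heckeOperator_zpowDiagGL_apply_eq_smul [Finite 𝓀[F]] [IsDiscreteValuationRing 𝒪[F]] (hϖ : IsUniformizingElement ϖ)
    (ρ : Representation k (GL (Fin 2) F) V) {v : V} (hv : v ∈ ρ.fixedPoints (glInt 2 F)) {a₁ ω : k}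
    (hT : heckeOperator ρ (glInt 2 F) (zpowDiagGL hϖ.ne_zero ![(1 : ℤ), 0]) v = a₁ • v)
    (hZ : heckeOperator ρ (glInt 2 F) (zpowDiagGL hϖ.ne_zero (fun _ : Fin 2 => (1 : ℤ))) v = ω • v)
    (e : ℕ → k) (he0 : e 0 = 1) (he1 : e 1 = a₁) (he2 : e 2 = a₁ ^ 2 - ((Nat.card 𝓀[F] : k) + 1) * ω)
    (he : ∀ m, e (m + 3) = a₁ * e (m + 2) - (Nat.card 𝓀[F] : k) * ω * e (m + 1)) (m : ℕ) :
    heckeOperator ρ (glInt 2 F) (zpowDiagGL hϖ.ne_zero ![(m : ℤ), 0]) v = e m • v := by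
  -- the auxiliary sequence `r_m` (eigenvalues of `T(ϖ^m)`)
  obtain ⟨r, hr0, hr1, hr⟩ : ∃ r : ℕ → k, r 0 = 1 ∧ r 1 = a₁ ∧ ∀ m, r (m + 2) = a₁ * r (m + 1) - (Nat.card 𝓀[F] : k) * ω * r m :=
    ⟨fun m => (Nat.rec ((1 : k), a₁) (fun _ p => (p.2, a₁ * p.2 - (Nat.card 𝓀[F] : k) * ω * p.1)) m : k × k).1,
      rfl, rfl, fun _ => rfl⟩
  have hρz : ρ (zpowDiagGL hϖ.ne_zero (fun _ : Fin 2 => (1 : ℤ))) v = ω • v := by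
    rw [← heckeOperator_apply_of_comm ρ (glInt 2 F) (glInt_mul_scalar_comm hϖ.ne_zero) hv, hZ]
  have hdet := heckeDetOperator_apply_eq_smul_of_eigen hϖ ρ hv hT hZ r hr0 hr1 hr
  -- `e_{m+2} = r_{m+2} − ω r_m`
  have her : ∀ m, e (m + 2) = r (m + 2) - ω * r m := by
    have h2 : e 2 = r 2 - ω * r 0 := by rw [he2, hr 0, hr1, hr0]; ring
    have h3 : e 3 = r 3 - ω * r 1 := by rw [he 0, he2, he1, hr 1, hr 0, hr1, hr0]; ring
    suffices h : ∀ m, e (m + 2) = r (m + 2) - ω * r m ∧ e (m + 3) = r (m + 3) - ω * r (m + 1) from fun m => (h m).1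
    intro m
    induction m with
    | zero => exact ⟨h2, h3⟩
    | succ m ih =>
      refine ⟨ih.2, ?_⟩
      show e (m + 4) = r (m + 4) - ω * r (m + 2)
      have e4 : e (m + 4) = a₁ * e (m + 3) - (Nat.card 𝓀[F] : k) * ω * e (m + 2) := he (m + 1)
      have r4 : r (m + 4) = a₁ * r (m + 3) - (Nat.card 𝓀[F] : k) * ω * r (m + 2) := hr (m + 2)
      rw [e4, ih.1, ih.2, r4, hr m]
      ring
  match m with
  | 0 => rw [zpowDiagGL_zero_zero hϖ.ne_zero, heckeOperator_one_apply ρ _ hv, he0, one_smul]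
  | 1 => rw [Nat.cast_one, hT, he1]
  | m + 2 =>
    have hsplit := heckeDetOperator_add_two_apply hϖ ρ m hv
    rw [hdet, hdet, map_smul, hρz, smul_smul] at hsplit
    rw [her, sub_smul, eq_sub_iff_add_eq, mul_comm ω (r m), ← hsplit]

end Summit.HodgeConjecture.HodgeConjecture.Cruxes.HLiu418.K2LiuGL2HeckePrimitiveSplit

end
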